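import Literature.NumberTheory.DiophantineGeometry.AbcHeightBoundFreyHellegouarchProofs
import Literature.NumberTheory.DiophantineGeometry.ConductorRadicalProofs
import Literature.NumberTheory.EllipticCurves.HeightConductorBoundsPropTenEightAsymptoticProofs
import HarnessLib

/-!
# von Känel–Matschke, (eq:asymptoticsu): `log max(|a|,|b|,|c|) ≤ (9/5) r log r + O(r log r / log log r)`
# from Lemma 10.5 and the asymptotic (eq:szpiro) — the printed deduction of §10.4, in kernel

Topic `Literature/NumberTheory/DiophantineGeometry` (family `abc`, LADDER-ABC A1: the *modular method*).
Theorems only — NO new statement, NO new named fact (D-0026). R. von Känel, B. Matschke,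
arXiv:1605.06079 = Mem. AMS **286** (2023) no. 1419 [`VonkanelMatschke2023`], §10.4, after the proof
of Prop. 10.6: *"Let `(a,b,c)` be a solution of (eq:abc). Lemma 10.5 associates to `(a,b,c)` an
elliptic `E` over `ℚ` with conductor `N_E` that satisfies `N_E → ∞` if `rad(abc) → ∞`. Therefore the
arguments of Proposition 10.6 together with the asymptotic bound obtained below (eq:szpiro) show that any
solution `(a,b,c)` of (eq:abc) with `rad(abc) = r` satisfies
`log max(|a|,|b|,|c|) ≤ (9/5) r log r + O(r log r / log log r)` for `r → ∞`."*

Over the tree (`S` = the primes of `abc`, `N_S = r`):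
* `N_E → ∞`: `rad(N_E) = rad(Δ_E)` (`radical_conductorNorm_eq_holds`, PROVED) and Lemma 10.5's
  `Δ_E ∈ {2⁴(abc)², 2⁻⁸(abc)²}` give `r ≤ 2 N_E` (`two_mul_conductorNorm_ge`);
* the arguments of Prop. 10.6 (`AbcHeightBoundFreyHellegouarchProofs`): `(|c|−1)⁵ ≤ 2²⁸ Δ_{E'}`,
  `N_{E'} = N_E ∣ 2⁴ r` (Ogg–Saito schema), and `ν(N_E) ≤ 12 r` (`ν ≤ (3/4)N` when `4 ∣ N`, else
  `N_E ≤ 2r`);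
* the asymptotic (eq:szpiro) with `δ = 1`: `log Δ_{E'} ≤ (3/4) ν log N + ((log 2 + 1)/log log N) ν log N`
  for `N ≥ N₀`; with `log N ≤ log r + log 16`, `log log N ≥ ½ log log r` (`r ≥ 60`) the lower-order
  terms are `≤ 24 · r log r / log log r`, so `(C, r₀) = (24, 2N₀ + 60)` witnesses the `O`.
* `eq_asymptoticsu_of_roots`: **(eq:asymptoticsu) ⟸ {modularity, Ogg–Saito schema, Lemma 10.5,
  Prop. 10.8 (i)}** (the asymptotic (eq:szpiro) being ⟸ {modularity, Prop. 10.8 (i)} by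
  `log_minimalDiscriminant_le_asymptotic_of_prop_10_8_i`, Prop. 10.8 (iii) DISCHARGED);
  `eq_asymptoticsu_of_lemma_10_5_of_conductorNorm_eq` takes the conductor invariance as a hypothesis.

No `abc` claim; typed ≠ proved: the roots remain named facts. All theorems; axioms standard.

## References

* R. von Känel, B. Matschke, arXiv:1605.06079 (2016) = Mem. AMS 286 (2023), §10.4 (display
  (eq:asymptoticsu)), Lemma 10.5, §10.5.3 ((eq:szpiro)). [VonkanelMatschke2023]
* J. H. Silverman, *The Arithmetic of Elliptic Curves*, 2nd ed. (2009), VII.5.1(a), VIII.11 (`N_E` and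
  `Δ_E` have the same primes). [SilvermanAEC2009]
-/

noncomputable section

open Height WeierstrassCurve
open Literature.NumberTheory.EllipticCurves
open Literature.NumberTheory.EllipticCurves.ModularForms

namespace Literature.NumberTheory.DiophantineGeometry

namespace VonKanelMatschke

/-! ### `ν(N) ≤ (3/4) N` for `4 ∣ N` -/

/-- `ν(N) = N ∏_{p² ∣ N}(1 − p⁻²) ≤ (3/4) N` when `4 ∣ N`. [cite: VonkanelMatschke2023, §10.4 (eq:nuineq)] -/
theorem condNu_le_three_fourths {M : ℕ} (hM0 : M ≠ 0) (h4 : 4 ∣ M) : condNu M ≤ 3 / 4 * (M : ℝ) := by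
  unfold condNu
  set s : Finset ℕ := M.primeFactors.filter (fun p => p ^ 2 ∣ M) with hs
  have h2s : 2 ∈ s := Finset.mem_filter.mpr
    ⟨Nat.mem_primeFactors.mpr ⟨Nat.prime_two, dvd_trans (by norm_num) h4, hM0⟩, by simpa using h4⟩
  have hf01 : ∀ p ∈ s, 0 ≤ 1 - 1 / (p : ℝ) ^ 2 ∧ 1 - 1 / (p : ℝ) ^ 2 ≤ 1 := by
    intro p hp
    have hp2 : (2 : ℝ) ≤ p := by
      exact_mod_cast (Nat.prime_of_mem_primeFactors (Finset.mem_filter.mp hp).1).two_le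
    have h1 : 0 < (p : ℝ) ^ 2 := by positivity
    have h2 : 1 / (p : ℝ) ^ 2 ≤ 1 := by rw [div_le_one h1]; nlinarith
    have h3 : 0 ≤ 1 / (p : ℝ) ^ 2 := by positivity
    exact ⟨by linarith, by linarith⟩
  have hrest : ∏ p ∈ s.erase 2, (1 - 1 / (p : ℝ) ^ 2) ≤ 1 :=
    Finset.prod_le_one (fun p hp => (hf01 p (Finset.mem_of_mem_erase hp)).1)
      (fun p hp => (hf01 p (Finset.mem_of_mem_erase hp)).2)
  have hrest0 : 0 ≤ ∏ p ∈ s.erase 2, (1 - 1 / (p : ℝ) ^ 2) :=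
    Finset.prod_nonneg fun p hp => (hf01 p (Finset.mem_of_mem_erase hp)).1
  rw [← Finset.mul_prod_erase s _ h2s]
  have hM : (0 : ℝ) ≤ M := by positivity
  nlinarith [mul_nonneg hM hrest0]

/-! ### `N_E → ∞` as `rad(abc) → ∞`: `rad(abc) ≤ 2 N_E` for the curve of Lemma 10.5 -/

/-- For `n = |abc| ≠ 0` even and `Δ ≠ 0` with `Δ = 2⁴ n²` or `2⁸ Δ = n²`: `rad(n) ≤ 2 rad(Δ)`.
[cite: VonkanelMatschke2023, §10.4 ("N_E → ∞ if rad(abc) → ∞")] -/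
private theorem radical_le_two_mul_radical {n D : ℕ} (hn : n ≠ 0) (hD : D ≠ 0) (h2 : 2 ∣ n)
    (h : D = 2 ^ 4 * n ^ 2 ∨ 2 ^ 8 * D = n ^ 2) :
    UniqueFactorizationMonoid.radical n ≤ 2 * UniqueFactorizationMonoid.radical D := by
  classical
  rw [Nat.radical_eq_prod_primeFactors, Nat.radical_eq_prod_primeFactors]
  have h2n : 2 ∈ n.primeFactors := Nat.mem_primeFactors.mpr ⟨Nat.prime_two, h2, hn⟩
  have hpos : 0 < ∏ p ∈ D.primeFactors, p :=
    Finset.prod_pos fun p hp ↦ (Nat.prime_of_mem_primeFactors hp).pos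
  rcases h with h | h
  · -- `pf(D) = {2} ∪ pf(n) = pf(n)`
    have hpf : D.primeFactors = n.primeFactors := by
      rw [h, Nat.primeFactors_mul (by norm_num) (pow_ne_zero 2 hn),
        Nat.primeFactors_prime_pow (by norm_num) Nat.prime_two, Nat.primeFactors_pow n two_ne_zero]
      exact Finset.union_eq_right.mpr (Finset.singleton_subset_iff.mpr h2n)
    rw [hpf]
    omega
  · -- `pf(n) = pf(2⁸ D) = {2} ∪ pf(D)`
    have hpf : n.primeFactors = insert 2 D.primeFactors := by
      rw [← Nat.primeFactors_pow n two_ne_zero, ← h, Nat.primeFactors_mul (by norm_num) hD,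
        Nat.primeFactors_prime_pow (by norm_num) Nat.prime_two, Finset.insert_eq]
    rw [hpf]
    by_cases h2D : 2 ∈ D.primeFactors
    · rw [Finset.insert_eq_of_mem h2D]; omega
    · rw [Finset.prod_insert h2D]

/-- **`rad(abc) ≤ 2 N_E`** for the curve `E` that Lemma 10.5 associates to `(a, b, c)`
(`Δ_E ∈ {2⁴(abc)², 2⁻⁸(abc)²}`, `abc` even): since `rad(N_E) = rad(Δ_E)` and `rad(N_E) ≤ N_E`. This is
the printed "`N_E → ∞` if `rad(abc) → ∞`". [cite: VonkanelMatschke2023, §10.4 (before (eq:asymptoticsu))]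
[cite: SilvermanAEC2009, VII.5.1(a)] -/
theorem radical_le_two_mul_conductorNorm (W : WeierstrassCurve ℚ) [W.IsElliptic] {n : ℕ} (hn : n ≠ 0)
    (h2 : 2 ∣ n) (h : W.minimalDiscriminantNorm ℤ = 2 ^ 4 * n ^ 2 ∨ 2 ^ 8 * W.minimalDiscriminantNorm ℤ = n ^ 2) :
    UniqueFactorizationMonoid.radical n ≤ 2 * W.conductorNorm ℤ := by
  have hD : W.minimalDiscriminantNorm ℤ ≠ 0 := (minimalDiscriminantNorm_pos_holds W).ne'
  have hN : W.conductorNorm ℤ ≠ 0 := (conductorNorm_pos_holds W).ne'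
  have h1 := radical_le_two_mul_radical hn hD h2 h
  have h2 : UniqueFactorizationMonoid.radical (W.minimalDiscriminantNorm ℤ) =
      UniqueFactorizationMonoid.radical (W.conductorNorm ℤ) := W.radical_conductorNorm_eq_holds.symm
  have h3 : UniqueFactorizationMonoid.radical (W.conductorNorm ℤ) ≤ W.conductorNorm ℤ :=
    Nat.le_of_dvd (Nat.pos_of_ne_zero hN) UniqueFactorizationMonoid.radical_dvd_self
  rw [h2] at h1
  omega

/-! ### The case `H = |c|` -/

/-- The analytic tail: with `r ≥ 60`, `ν ≥ 0`, `ν ≤ 12 r`, `log N ≤ log r + log 16`,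
`log N ≥ log r − log 2`, the asymptotic (eq:szpiro) at `δ = 1` and `(|c|−1)⁵ ≤ 2²⁸ Δ`, `|c| ≥ 2`:
`log|c| ≤ (9/5) r log r + 24 · r log r / log log r`. [cite: VonkanelMatschke2023, §10.4 (eq:asymptoticsu)] -/
private theorem asym_tail {r ν LN D C : ℝ} (hr : 60 ≤ r) (hν0 : 0 ≤ ν) (hν : ν ≤ 12 * r)
    (hLN : LN ≤ Real.log r + Real.log 16) (hLN' : Real.log r - Real.log 2 ≤ LN)
    (hD : Real.log D ≤ 3 / 4 * ν * LN + (Real.log 2 + 1) / Real.log LN * (ν * LN))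
    (hC2 : 2 ≤ C) (hCD : (C - 1) ^ 5 ≤ 2 ^ 28 * D) (hD0 : 0 < D) :
    Real.log C ≤ 9 / 5 * r * Real.log r + 24 * (r * Real.log r / Real.log (Real.log r)) := by
  have hl2 := Real.log_two_lt_d9
  have hl2' := Real.log_two_gt_d9
  have he := Real.exp_one_lt_d9
  have he' := Real.exp_one_gt_d9
  have hr0 : 0 < r := by linarith
  -- `log r ≥ 4`, `log 16 ≤ 2.78`
  have hL4 : 4 ≤ Real.log r := by
    rw [Real.le_log_iff_exp_le hr0, show (4 : ℝ) = ((4 : ℕ) : ℝ) by norm_num, ← Real.exp_one_pow]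
    have : Real.exp 1 ^ 4 < 2.7182818286 ^ 4 := pow_lt_pow_left₀ he (Real.exp_pos 1).le (by norm_num)
    nlinarith
  have h16 : Real.log 16 ≤ 2.78 := by
    rw [show (16 : ℝ) = 2 ^ 4 by norm_num, Real.log_pow]; push_cast; linarith
  -- `LL = log log r ≥ log 4 > 1`, `LL ≤ log r`
  have hLL1 : 1 < Real.log (Real.log r) := by
    rw [Real.lt_log_iff_exp_lt (by linarith)]; linarith
  have hLL0 : 0 < Real.log (Real.log r) := by linarith
  have hLLle : Real.log (Real.log r) ≤ Real.log r := (Real.log_le_sub_one_of_pos (by linarith)).trans (by linarith)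
  -- `log LN ≥ ½ log log r > 0`
  have hLNpos : 0 < LN := by linarith
  have hsq : Real.log r ≤ (Real.log r - Real.log 2) ^ 2 := by nlinarith
  have hlogLN : Real.log (Real.log r) ≤ 2 * Real.log LN := by
    have h1 : Real.log (Real.log r) ≤ Real.log ((Real.log r - Real.log 2) ^ 2) :=
      Real.log_le_log (by linarith) hsq
    have h2 : Real.log ((Real.log r - Real.log 2) ^ 2) = 2 * Real.log (Real.log r - Real.log 2) := by
      rw [Real.log_pow]; push_cast; ring
    have h3 : Real.log (Real.log r - Real.log 2) ≤ Real.log LN := Real.log_le_log (by linarith) hLN'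
    linarith
  have hlLNpos : 0 < Real.log LN := by linarith
  -- the coefficient `(log 2 + 1)/log LN ≤ 3.4 / log log r`
  have hcoef : (Real.log 2 + 1) / Real.log LN ≤ 3.4 / Real.log (Real.log r) := by
    rw [div_le_div_iff₀ hlLNpos hLL0]; nlinarith
  -- `ν log N ≤ 12 r log r + 33.36 r`
  have hT1 : ν * LN ≤ 12 * r * Real.log r + 33.36 * r := by
    have h1 : ν * LN ≤ ν * (Real.log r + 2.78) := mul_le_mul_of_nonneg_left (by linarith) hν0
    have h2 : ν * (Real.log r + 2.78) ≤ 12 * r * (Real.log r + 2.78) :=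
      mul_le_mul_of_nonneg_right hν (by linarith)
    linarith
  have hT1' : 0 ≤ ν * LN := mul_nonneg hν0 hLNpos.le
  have hT3 : (Real.log 2 + 1) / Real.log LN * (ν * LN) ≤
      3.4 / Real.log (Real.log r) * (12 * r * Real.log r + 33.36 * r) :=
    mul_le_mul hcoef hT1 hT1' (by positivity)
  have e3 : 3.4 / Real.log (Real.log r) * (12 * r * Real.log r + 33.36 * r) =
      40.8 * (r * Real.log r / Real.log (Real.log r)) + 113.424 * (r / Real.log (Real.log r)) := by
    ring
  -- `r / LL ≤ W / 4`, `r ≤ W`, `W ≥ 60`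
  have hT4 : r / Real.log (Real.log r) * 4 ≤ r * Real.log r / Real.log (Real.log r) := by
    rw [div_mul_eq_mul_div]
    exact div_le_div_of_nonneg_right (by nlinarith) hLL0.le
  have hT5 : r ≤ r * Real.log r / Real.log (Real.log r) := by
    rw [le_div_iff₀ hLL0]; exact mul_le_mul_of_nonneg_left hLLle hr0.le
  -- `(|c|−1)⁵ ≤ 2²⁸ Δ`
  have hC1 : 0 < C - 1 := by linarith
  have h3 : 5 * Real.log (C - 1) ≤ 28 * Real.log 2 + Real.log D := by
    have := Real.log_le_log (by positivity) hCD
    rw [Real.log_pow, Real.log_mul (by norm_num) hD0.ne', Real.log_pow] at this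
    push_cast at this; linarith
  have h4 : Real.log C ≤ Real.log 2 + Real.log (C - 1) := by
    rw [← Real.log_mul (by norm_num) hC1.ne']
    exact Real.log_le_log (by linarith) (by linarith)
  have h5 : 3 / 4 * ν * LN ≤ 3 / 4 * (12 * r * Real.log r + 33.36 * r) := by linarith
  nlinarith [hT3, e3, hT4, hT5, h3, h4, h5, hD]

/-- The case `H = |c|` of (eq:asymptoticsu) (`|a|, |b| ≤ |c|`), for the set `S` of primes of `abc`
(`N_S = r = rad(abc)`), granted the Ogg–Saito schema, Lemma 10.5 and the asymptotic (eq:szpiro) at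
`δ = 1` beyond `N₀`: if `r ≥ 2N₀ + 60` then `log|c| ≤ (9/5) r log r + 24 r log r/log log r`.
[cite: VonkanelMatschke2023, §10.4 (derivation of (eq:asymptoticsu))] -/
private theorem asym_core
    (hcond : ∀ (W W' : WeierstrassCurve ℚ) [W.IsElliptic] [W'.IsElliptic], W.IsIsogenous W' → W.conductorNorm ℤ = W'.conductorNorm ℤ)
    (h105 : vonKanelMatschke_lemma_10_5) {N₀ : ℕ}
    (hN₀ : ∀ (W : WeierstrassCurve ℚ) [W.IsElliptic], N₀ ≤ W.conductorNorm ℤ →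
      Real.log (W.minimalDiscriminantNorm ℤ) ≤
        3 / 4 * condNu (W.conductorNorm ℤ) * Real.log (W.conductorNorm ℤ) +
          (Real.log 2 + 1) / Real.log (Real.log (W.conductorNorm ℤ)) *
            (condNu (W.conductorNorm ℤ) * Real.log (W.conductorNorm ℤ)))
    {a b c : ℤ} (ha : a ≠ 0) (hb : b ≠ 0) (hc : c ≠ 0) (habc : a + b = c)
    (hg : Int.gcd (Int.gcd a b : ℤ) c = 1) (hac : |a| ≤ |c|) (hbc : |b| ≤ |c|)
    (hr : (2 * N₀ + 60 : ℝ) ≤ ((intRad (a * b * c) : ℕ) : ℝ)) :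
    Real.log |(c : ℝ)| ≤
      9 / 5 * ((intRad (a * b * c) : ℕ) : ℝ) * Real.log ((intRad (a * b * c) : ℕ) : ℝ) +
        24 * (((intRad (a * b * c) : ℕ) : ℝ) * Real.log ((intRad (a * b * c) : ℕ) : ℝ) /
          Real.log (Real.log ((intRad (a * b * c) : ℕ) : ℝ))) := by
  classical
  have hc2 : 2 ≤ |c| := by
    by_contra hlt
    have hc1 : |c| ≤ 1 := by rw [not_le] at hlt; omega
    obtain ⟨hc1a, hc1b⟩ := abs_le.mp hc1
    obtain ⟨ha1, ha2⟩ := abs_le.mp (hac.trans hc1)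
    obtain ⟨hb1, hb2⟩ := abs_le.mp (hbc.trans hc1)
    omega
  have hab : |c| - 1 ≤ |a| * |b| := by
    have h1 : |c| ≤ |a| + |b| := by rw [← habc]; exact abs_add_le a b
    nlinarith [Int.one_le_abs ha, Int.one_le_abs hb]
  -- `S` = primes of `abc`, `N_S = rad(abc) = r`
  set n : ℕ := (a * b * c).natAbs with hndef
  have hn0 : n ≠ 0 := Int.natAbs_ne_zero.mpr (mul_ne_zero (mul_ne_zero ha hb) hc)
  set S : Finset ℕ := n.primeFactors with hSdef
  have hS : ∀ p ∈ S, p.Prime := fun p hp ↦ Nat.prime_of_mem_primeFactors hp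
  have hradS : UniqueFactorizationMonoid.radical n = primesProd S := by
    rw [primesProd, Nat.radical_eq_prod_primeFactors]
  have hrP : intRad (a * b * c) = primesProd S := by rw [intRad_def, ← hradS]
  rw [hrP] at hr ⊢
  obtain ⟨W, W', hW, hW', hiso, hNdvd, -, hΔW, m, hm3, hΔ'⟩ :=
    h105 S hS a b c ha hb hc habc hg (hradS ▸ dvd_rfl)
  haveI := hW
  haveI := hW'
  set N : ℕ := W.conductorNorm ℤ with hNdef
  have hN0 : N ≠ 0 := (conductorNorm_pos_holds W).ne'
  have hN'eq : W'.conductorNorm ℤ = N := (hcond W W' hiso).symm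
  have hΔ'pos : 0 < W'.minimalDiscriminantNorm ℤ := minimalDiscriminantNorm_pos_holds _
  set P : ℕ := primesProd S with hPdef
  -- `abc` is even, `r ≤ 2 N`
  have h2dvd : (2 : ℤ) ∣ a * b * c := by
    rcases Int.even_or_odd a with hA | hA
    · exact ((even_iff_two_dvd.mp hA).mul_right b).mul_right c
    · rcases Int.even_or_odd b with hB | hB
      · exact ((even_iff_two_dvd.mp hB).mul_left a).mul_right c
      · have hCe : Even c := by rw [← habc]; exact hA.add_odd hB
        exact (even_iff_two_dvd.mp hCe).mul_left (a * b)
  have h2n : 2 ∣ n := Int.natAbs_dvd_natAbs.mpr h2dvd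
  have hP2N : P ≤ 2 * N := by
    have := radical_le_two_mul_conductorNorm W hn0 h2n hΔW
    rwa [hradS] at this
  have hN₀N : N₀ ≤ N := by
    have : (2 * N₀ + 60 : ℝ) ≤ 2 * (N : ℝ) := hr.trans (by exact_mod_cast hP2N)
    have : (N₀ : ℝ) ≤ N := by linarith
    exact_mod_cast this
  -- the asymptotic (eq:szpiro) for `E'` (conductor `N`)
  have hszW := hN₀ W' (by rw [hN'eq]; exact hN₀N)
  rw [hN'eq] at hszW
  -- `ν(N) ≤ 12 r`: `N = 2^k N_odd`, `N_odd ∣ r`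
  set k : ℕ := padicValNat 2 N with hkdef
  obtain ⟨Nodd, hNodd⟩ : 2 ^ k ∣ N := pow_padicValNat_dvd
  have hNodd0 : Nodd ≠ 0 := by rintro rfl; rw [mul_zero] at hNodd; exact hN0 hNodd
  have hNodd2 : ¬ 2 ∣ Nodd := by
    rintro ⟨u, hu⟩
    have : 2 ^ (k + 1) ∣ N := ⟨u, by rw [hNodd, hu]; ring⟩
    exact pow_succ_padicValNat_not_dvd (p := 2) hN0 this
  have hNoddP : Nodd ≤ P := by
    have h1 : Nodd ∣ 2 ^ 4 * P := (Dvd.intro_left _ hNodd.symm).trans hNdvd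
    have hcop : Nat.Coprime Nodd (2 ^ 4) :=
      Nat.Coprime.pow_right 4 ((Nat.Prime.coprime_iff_not_dvd Nat.prime_two).mpr hNodd2).symm
    exact Nat.le_of_dvd (one_le_primesProd hS) (hcop.dvd_of_dvd_mul_left h1)
  have hν0 : 0 ≤ condNu N := condNu_nonneg N
  have hP0 : (0 : ℝ) ≤ P := by positivity
  have hν12 : condNu N ≤ 12 * (P : ℝ) := by
    by_cases h4 : 4 ∣ N
    · have h1 := condNu_le_three_fourths hN0 h4
      have h2 : (N : ℝ) ≤ 16 * P := by
        exact_mod_cast Nat.le_of_dvd (by linarith [one_le_primesProd hS]) hNdvd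
      linarith
    · have hk1 : k ≤ 1 := by
        by_contra hk2
        refine h4 ?_
        have h := (pow_dvd_pow 2 (show 2 ≤ k by omega)).trans (Dvd.intro _ hNodd.symm)
        norm_num at h
        exact h
      have h1 : N ≤ 2 * Nodd := by
        rw [hNodd]
        have : 2 ^ k ≤ 2 := by interval_cases k <;> norm_num
        exact Nat.mul_le_mul_right _ this
      have h2 : (N : ℝ) ≤ 2 * P := by exact_mod_cast h1.trans (Nat.mul_le_mul_left 2 hNoddP)
      linarith [condNu_le_self N]
  -- `log N` versus `log r`
  have hP60 : (60 : ℝ) ≤ P := le_trans (by linarith [(Nat.cast_nonneg N₀ : (0 : ℝ) ≤ N₀)]) hr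
  have hPpos : (0 : ℝ) < P := by linarith
  have hNpos : (0 : ℝ) < N := by exact_mod_cast Nat.pos_of_ne_zero hN0
  have hLN : Real.log (N : ℝ) ≤ Real.log P + Real.log 16 := by
    have h1 : (N : ℝ) ≤ 16 * P := by
      exact_mod_cast Nat.le_of_dvd (by linarith [one_le_primesProd hS]) hNdvd
    have := Real.log_le_log hNpos h1
    rw [Real.log_mul (by norm_num) hPpos.ne'] at this
    linarith
  have hLN' : Real.log (P : ℝ) - Real.log 2 ≤ Real.log N := by
    have h1 : (P : ℝ) / 2 ≤ N := by
      rw [div_le_iff₀ (by norm_num : (0 : ℝ) < 2)]; exact_mod_cast (mul_comm 2 N ▸ hP2N)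
    have := Real.log_le_log (by positivity) h1
    rwa [Real.log_div hPpos.ne' (by norm_num)] at this
  -- `(|c| − 1)⁵ ≤ 2²⁸ Δ'`
  have hD0 : (0 : ℝ) < (W'.minimalDiscriminantNorm ℤ : ℝ) := by exact_mod_cast hΔ'pos
  have hc2r : (2 : ℝ) ≤ |(c : ℝ)| := by exact_mod_cast hc2
  have habr : |(c : ℝ)| - 1 ≤ |(a : ℝ)| * |(b : ℝ)| := by exact_mod_cast hab
  have hΔr : (2 : ℝ) ^ (12 * m) * (W'.minimalDiscriminantNorm ℤ : ℝ) =
      2 ^ 8 * (|(a : ℝ)| * |(b : ℝ)|) * |(c : ℝ)| ^ 4 := by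
    have h' : ((2 ^ (12 * m) * W'.minimalDiscriminantNorm ℤ : ℕ) : ℝ) =
        ((2 ^ 8 * (a * b).natAbs * c.natAbs ^ 4 : ℕ) : ℝ) := by exact_mod_cast hΔ'
    push_cast [Int.natAbs_mul, Nat.cast_natAbs, Int.cast_abs] at h'
    linarith
  have hm : (2 : ℝ) ^ (12 * m) ≤ 2 ^ 36 := pow_le_pow_right₀ (by norm_num) (by omega)
  have hCD : (|(c : ℝ)| - 1) ^ 5 ≤ 2 ^ 28 * (W'.minimalDiscriminantNorm ℤ : ℝ) := by
    have h0 : 0 ≤ |(c : ℝ)| - 1 := by linarith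
    have h1 : (|(c : ℝ)| - 1) ^ 4 ≤ |(c : ℝ)| ^ 4 := pow_le_pow_left₀ h0 (by linarith) 4
    have h2 : (|(c : ℝ)| - 1) ^ 5 ≤ (|(a : ℝ)| * |(b : ℝ)|) * |(c : ℝ)| ^ 4 := by
      rw [pow_succ']
      exact mul_le_mul habr h1 (by positivity) (by positivity)
    have h3 : (|(a : ℝ)| * |(b : ℝ)|) * |(c : ℝ)| ^ 4 ≤ 2 ^ 28 * (W'.minimalDiscriminantNorm ℤ : ℝ) := by
      nlinarith
    linarith
  exact asym_tail hP60 hν0 hν12 hLN hLN' hszW hc2r hCD hD0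

/-! ### (eq:asymptoticsu) -/

/-- **vKM (eq:asymptoticsu) ⟸ Lemma 10.5 + asymptotic (eq:szpiro)** (PROVED deduction of §10.4, granted
isogeny invariance of the conductor `hcond`): with `(C, r₀) = (24, 2N₀(1) + 60)`, every solution of (eq:abc)
with `r = rad(abc) ≥ r₀` has `log max(|a|,|b|,|c|) ≤ (9/5) r log r + C · r log r / log log r`; the
cases `H = |a|`, `|b|` by the solutions `(b, −c, −a)`, `(a, −c, −b)`.
[cite: VonkanelMatschke2023, §10.4 display (eq:asymptoticsu) and the sentence deriving it] -/
theorem eq_asymptoticsu_of_lemma_10_5_of_conductorNorm_eq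
    (hcond : ∀ (W W' : WeierstrassCurve ℚ) [W.IsElliptic] [W'.IsElliptic], W.IsIsogenous W' → W.conductorNorm ℤ = W'.conductorNorm ℤ)
    (h105 : vonKanelMatschke_lemma_10_5)
    (hasz : vonKanelMatschke_log_minimalDiscriminant_le_asymptotic) : eq_asymptoticsu := by
  obtain ⟨N₀, hN₀⟩ := hasz 1 one_pos
  refine ⟨24, 2 * N₀ + 60, fun a b c ha hb hc habc hg hr ↦ ?_⟩
  have hg' : ∀ x y z : ℤ, Int.gcd (Int.gcd x y : ℤ) z = 1 → Int.gcd (Int.gcd y (-z) : ℤ) (-x) = 1 := by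
    intro x y z h; simp only [Int.gcd, Int.natAbs_neg, Int.natAbs_natCast] at h ⊢
    rwa [Nat.gcd_comm, ← Nat.gcd_assoc]
  have hg'' : ∀ x y z : ℤ, Int.gcd (Int.gcd x y : ℤ) z = 1 → Int.gcd (Int.gcd x (-z) : ℤ) (-y) = 1 := by
    intro x y z h; simp only [Int.gcd, Int.natAbs_neg, Int.natAbs_natCast] at h ⊢
    rwa [Nat.gcd_assoc, Nat.gcd_comm z.natAbs, ← Nat.gcd_assoc]
  push_cast
  have cast_le : ∀ {x y : ℤ}, |x| ≤ |y| → |(x : ℝ)| ≤ |(y : ℝ)| := fun h => by exact_mod_cast h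
  have eB : a * -c * -b = a * b * c := by ring
  have eA : b * -c * -a = a * b * c := by ring
  rcases le_total |a| |c| with hac | hca
  · rcases le_total |b| |c| with hbc | hcb
    · rw [max_eq_right (cast_le hbc), max_eq_right (cast_le hac)]
      exact asym_core hcond h105 hN₀ ha hb hc habc hg hac hbc hr
    · rw [max_eq_left (cast_le hcb), max_eq_right (cast_le (hac.trans hcb))]
      have key := asym_core hcond h105 hN₀ ha (neg_ne_zero.mpr hc) (neg_ne_zero.mpr hb)
        (by linarith) (hg'' a b c hg) (by rw [abs_neg]; exact hac.trans hcb)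
        (by rw [abs_neg, abs_neg]; exact hcb) (by rw [eB]; exact hr)
      rw [eB] at key; push_cast [abs_neg] at key; exact key
  · rcases le_total |b| |a| with hba | hab
    · rw [max_eq_left (max_le (cast_le hba) (cast_le hca))]
      have key := asym_core hcond h105 hN₀ hb (neg_ne_zero.mpr hc) (neg_ne_zero.mpr ha)
        (by linarith) (hg' a b c hg) (by rw [abs_neg]; exact hba)
        (by rw [abs_neg, abs_neg]; exact hca) (by rw [eA]; exact hr)
      rw [eA] at key; push_cast [abs_neg] at key; exact key
    · rw [max_eq_left (cast_le (hca.trans hab)), max_eq_right (cast_le hab)]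
      have key := asym_core hcond h105 hN₀ ha (neg_ne_zero.mpr hc) (neg_ne_zero.mpr hb)
        (by linarith) (hg'' a b c hg) (by rw [abs_neg]; exact hab)
        (by rw [abs_neg, abs_neg]; exact hca.trans hab) (by rw [eB]; exact hr)
      rw [eB] at key; push_cast [abs_neg] at key; exact key

/-- **vKM (eq:asymptoticsu) ⟸ Lemma 10.5 + asymptotic (eq:szpiro)**, the conductor invariance supplied by the
Ogg–Saito schema (`conductorNorm_eq_of_isIsogenous_of_tate`). [cite: VonkanelMatschke2023, §10.4 display (eq:asymptoticsu)] -/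
theorem eq_asymptoticsu_of_lemma_10_5
    (hOS : ∀ (W : WeierstrassCurve ℚ) (ℓ : ℕ) [Fact ℓ.Prime], W.artinConductorExponent_tate_eq_conductorExponent_of_isElliptic ℓ)
    (h105 : vonKanelMatschke_lemma_10_5) (hasz : vonKanelMatschke_log_minimalDiscriminant_le_asymptotic) : eq_asymptoticsu :=
  eq_asymptoticsu_of_lemma_10_5_of_conductorNorm_eq (conductorNorm_eq_of_isIsogenous_of_tate hOS) h105 hasz

/-- **(eq:asymptoticsu) from the roots** (PROVED assembly): granted modularity, the Ogg–Saito schema,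
Lemma 10.5 and Prop. 10.8 (i) — the asymptotic (eq:szpiro) being a consequence of modularity and
Prop. 10.8 (i) with (iii) DISCHARGED (`log_minimalDiscriminant_le_asymptotic_of_prop_10_8_i`).
[cite: VonkanelMatschke2023, §10.4 display (eq:asymptoticsu) with §10.5.3] -/
theorem eq_asymptoticsu_of_roots (hmod : nonempty_modularParametrizationData)
    (hOS : ∀ (W : WeierstrassCurve ℚ) (ℓ : ℕ) [Fact ℓ.Prime],
      W.artinConductorExponent_tate_eq_conductorExponent_of_isElliptic ℓ)
    (h105 : vonKanelMatschke_lemma_10_5) (hi : vonKanelMatschke_prop_10_8_i) : eq_asymptoticsu :=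
  eq_asymptoticsu_of_lemma_10_5 hOS h105 (log_minimalDiscriminant_le_asymptotic_of_prop_10_8_i hmod hi)

end VonKanelMatschke

end Literature.NumberTheory.DiophantineGeometry

end
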